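import Literature.AlgebraicGeometry.ShimuraVarieties.UnitaryCurveAuxiliaryPeriodMap
import Literature.AlgebraicGeometry.ShimuraVarieties.UnitaryCurveAuxiliaryComplexStructureEquivariance
import Literature.AlgebraicGeometry.ModuliOfAbelianVarieties.SiegelSpaceComplexStructuresAction
import HarnessLib

/-!
# Equivariance of the period map `Z(v)` of `J_Φ` under the unitary group and commutation with the `M`-scalars (E6-eq, layer (a))
# (Deligne 1971, 1.14–1.15; Deligne 1979 Prop. 2.3.10; Lange, Lemma 7.1.7: `Z_{M J M⁻¹} = N_M • Z_J`)

Topic `AlgebraicGeometry/ShimuraVarieties`; namespace `Literature.AlgebraicGeometry.ShimuraVarieties.UnitaryCurve.AuxV`.  THEOREMS ONLY (no `def`, no named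
fact, no instance, no notation, no `sorry`).  Cell `hodgecm-mathlib` (D-0151), FLOOR 0, P6 «MOD programme», door (E) of `stub_RGD`, organ **E6-eq** (A-p06 (g32)
ROAD MAP v2 4f93b1fa, step 5 «independence of the lift `ṽ ↦ γ ṽ`»; dealt to A-p17 (g27) 2026-09-01T22:31:56Z; LEAD F0P6-plan (g2) 22:25:01Z owner's privilege).
`--supports stmt-HodgeConjecture-24832`, count-neutral; HC_CM is proved only modulo the printed citations until rung 0 closes.

LAYER (a) — the E2-currency content (★ E2 C `periodZV`, ★ E2b A4 `auxComplexStructureV_map_mulVec`, ★ Siegel `SiegelSpaceComplexStructuresAction`):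
for a rational unitary element `γ ∈ U(H)(L⁺)` acting on the cone by `γ^τ` and on the frame by the real similitude
`N_γ := gspRationalToReal δ (auxToGspRatV F (γ, 1)) = auxRepV ℝ β (1, X_γ)` (★ A4 `coe_gspRationalToReal_auxToGspRatV_one`), and any real `γ₀`:
* §1 `periodZV_mul` (`Z_{γ₀ g}(v) = Z(γ₀ (g J_Φ(v) g⁻¹) γ₀⁻¹)`), **`periodZV_map_mulVec`**: `Z_{γ₀}(γ^τ v) = Z_{γ₀ N_γ}(v)`;
* §2 `isMultiplier_one_gspRationalToReal_auxToGspRatV_one`: `N_γ ∈ Sp(E_δ)(ℝ)` (multiplier `1`: unitary part, trivial torus part), hence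
  `γ₀ N_γ γ₀⁻¹ ∈ spForm δ` for `γ₀ ∈ GSp_δ(ℝ)` (`conj_mem_spForm_of_mem_gspReal`);
* §3 THE MÖBIUS LAW **`periodZV_map_mulVec_eq_smul`**: for `γ₀ ∈ GSp_δ(ℝ)` with `γ₀ J_Φ(v) γ₀⁻¹ ∈ C0 δ`,
  `Z_{γ₀}(γ^τ v) = (toSpFormEquiv hδ)⁻¹ ⟨γ₀ N_γ γ₀⁻¹⟩ • Z_{γ₀}(v)` in `𝔥_g` (★ `c0EquivSiegel_smul`: `Z_{A • J} = (toSpFormEquiv⁻¹ A) • Z_J`);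
* §4 `auxRepV_unitary_mul_scalar`: `N_γ` (indeed `auxRepV ℝ β (1, X)` for any `X`) COMMUTES with every scalar `N_t = auxRepV ℝ β (t, 1)`, `t ∈ (ℝ ⊗_ℚ M)ˣ` — so
  `γ₀ N_γ γ₀⁻¹` commutes with `γ₀ N_t γ₀⁻¹`, the real avatar of the `𝒪_M`-action `Mρ` in the frame `γ₀` (A-p06 «`Mρ` commutes with `auxRep γ`»).
LAYER (b) (the (U2+) shape with an INTEGRAL `M ∈ Γ_δ(N)` commuting with the integral `Mρ` of E1 FILE 7) is E3-side bookkeeping on top of this file and of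
★ `SiegelShimuraSet.mk_eq_mk_iff`; not here.

## References
* [Deligne1971TravauxShimura] P. Deligne, *Travaux de Shimura* (1971), 1.14–1.15 and 5.4 (equivariance of the embedding of hermitian symmetric domains).
* [Deligne1979ShimuraVarieties] P. Deligne, *Variétés de Shimura* (1979), Prop. 2.3.10 and 2.1.2 (PDF pp. 32, 24 of Milne's translation).
* [Lange2023AbelianVarietiesComplex] H. Lange, *Abelian Varieties over the Complex Numbers* (2023), §7.1.2 Lemma 7.1.7 and Prop. 7.1.9 (p0327–p0328).
* [Milne2005ShimuraVarieties] J. S. Milne, *Introduction to Shimura varieties* (2005), Lemma 5.13 p. 57, §6 pp. 67–70.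
-/

set_option autoImplicit false

noncomputable section

open Matrix NumberField
open scoped TensorProduct ComplexConjugate Classical

namespace Literature.AlgebraicGeometry.ShimuraVarieties

namespace UnitaryCurve

namespace AuxV

open Literature.AlgebraicGeometry.ModuliOfAbelianVarieties
open Literature.AlgebraicGeometry.ModuliOfAbelianVarieties.SiegelModuli
open Literature.AlgebraicGeometry.Motives (CMType)
open Literature.NumberTheory.Automorphic (siegelUpperHalfSpace)
open Literature.NumberTheory.Automorphic.UnitaryGroup
open Literature.AlgebraicGeometry.ShimuraVarieties.UnitaryCanonicalModel.Aux (conjR ratBasis iPhi)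
open Literature.AlgebraicGeometry.ShimuraVarieties.UnitaryCurve.Aux (unitaryToTensorRat unitaryToTensorRat_unitary)

variable {L : Type} [Field L] [NumberField L] [IsCMField L] (M : Type) [Field M] [NumberField M] [IsCMField M] {j : L →+* M}
  {n : ℕ} {H : Matrix (Fin n) (Fin n) L} {ξ : M} {g : ℕ} {δ : Fin g → ℕ}
  (F : SymplecticFrameV M j H ξ g δ) (Φ : CMType M) (τ : L →+* ℂ)

/-! ### §1 `Z_{γ₀}(γ^τ v) = Z_{γ₀ N_γ}(v)` -/

omit [NumberField L] [IsCMField L] in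
/-- `Z_{γ₀ g}(v) = siegelOfJ (γ₀ (g J_Φ(v) g⁻¹) γ₀⁻¹)` (★ `conjJ_mul`). [cite: Lange2023AbelianVarietiesComplex, §7.1.2 (7.2)–(7.3)] -/
theorem periodZV_mul (γ₀ g' : GL (Fin g ⊕ Fin g) ℝ) (v : Fin n → ℂ) :
    periodZV M F Φ τ (γ₀ * g') v = siegelOfJ δ (conjJ γ₀ (conjJ g' (auxComplexStructureV F τ Φ v))) := by
  rw [periodZV, conjJ_mul]

/-- **`Z_{γ₀}(γ^τ v) = Z_{γ₀ N_γ}(v)`** for `γ ∈ U(H)(L⁺)` rational, `N_γ = gspRationalToReal δ (auxToGspRatV F (γ, 1))` (★ A4 `auxComplexStructureV_map_mulVec`: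
`J_Φ(γ^τ v) = N_γ J_Φ(v) N_γ⁻¹`). [cite: Deligne1971TravauxShimura, 1.14–1.15] [cite: Deligne1979ShimuraVarieties, Prop. 2.3.10 (PDF p. 32)] -/
theorem periodZV_map_mulVec (γ₀ : GL (Fin g ⊕ Fin g) ℝ) (γ : rational (↥(maximalRealSubfield L)) L (IsCMField.complexConj L) n H)
    (v : Fin n → ℂ) :
    periodZV M F Φ τ γ₀ (((Matrix.GeneralLinearGroup.map τ (γ : GL (Fin n) L) : GL (Fin n) ℂ) : Matrix (Fin n) (Fin n) ℂ) *ᵥ v) =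
      periodZV M F Φ τ (γ₀ * (gspRationalToReal δ (auxToGspRatV F (γ, 1)) : GL (Fin g ⊕ Fin g) ℝ)) v := by
  rw [periodZV, auxComplexStructureV_map_mulVec F τ Φ γ v, ← conjJ_mul, periodZV]

/-! ### §2 `N_γ ∈ Sp(E_δ)(ℝ)` and its conjugates by real similitudes -/

/-- **`N_γ` has multiplier `1`**: `auxToGspRatV F (γ, 1)` is symplectic (★ `isMultiplier_auxRepV` at the trivial torus element), and so is its real image.
[cite: Deligne1979ShimuraVarieties, Prop. 2.3.10 (PDF p. 32)] [cite: Milne2005ShimuraVarieties, §6 p. 67] -/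
theorem isMultiplier_one_gspRationalToReal_auxToGspRatV_one (γ : rational (↥(maximalRealSubfield L)) L (IsCMField.complexConj L) n H) :
    IsMultiplier (typeFormOver δ ℝ) (gspRationalToReal δ (auxToGspRatV F (γ, 1)) : GL (Fin g ⊕ Fin g) ℝ) 1 := by
  have hq : IsMultiplier (typeFormOver δ ℚ) (auxToGspRatV F (γ, 1) : GL (Fin g ⊕ Fin g) ℚ) 1 := by
    rw [coe_auxToGspRatV, map_one]
    refine isMultiplier_auxRepV ℚ F ?_ (unitaryToTensorRat_unitary M j H γ)
    rw [Units.val_one, map_one, one_mul, Units.val_one, map_one]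
  have h := hq.map (algebraMap ℚ ℝ)
  rw [typeFormOver_map, map_one] at h
  rw [coe_gspRationalToReal]
  exact h

/-- A symplectic element conjugated by a real similitude stays symplectic: `γ₀ N γ₀⁻¹ ∈ spForm δ` for `N` of multiplier `1` and `γ₀ ∈ GSp_δ(ℝ)`
(the multipliers cancel). [cite: Milne2005ShimuraVarieties, §6 p. 67] [cite: Lange2023AbelianVarietiesComplex, §7.1.2 Prop. 7.1.9 (p0328)] -/
theorem conj_mem_spForm_of_mem_gspReal {γ₀ N : GL (Fin g ⊕ Fin g) ℝ} (hγ₀ : γ₀ ∈ gspReal δ) (hN : IsMultiplier (typeFormOver δ ℝ) N 1) :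
    γ₀ * N * γ₀⁻¹ ∈ spForm δ := by
  obtain ⟨ν, hν⟩ := hγ₀
  have h := (hν.mul hN).mul hν.inv
  rw [mul_one, mul_inv_cancel] at h
  rw [spForm_eq_symplecticGroupOfForm]
  exact h

/-! ### §3 The Möbius law `Z_{γ₀}(γ^τ v) = A • Z_{γ₀}(v)` in `𝔥_g`, `A ↔ γ₀ N_γ γ₀⁻¹` -/

omit [NumberField L] [IsCMField L] in
/-- `Z_{γ₀}(v)` as a point of `𝔥_g` is `c0EquivSiegel` of the `C0`-point `γ₀ J_Φ(v) γ₀⁻¹`. [cite: Lange2023AbelianVarietiesComplex, §7.1.2 (7.2)–(7.3)] -/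
theorem periodZV_eq_c0EquivSiegel (hδ : ∀ i, 0 < δ i) {γ₀ : GL (Fin g ⊕ Fin g) ℝ} {v : Fin n → ℂ}
    (hC0 : conjJ γ₀ (auxComplexStructureV F τ Φ v) ∈ C0 δ) :
    periodZV M F Φ τ γ₀ v = ((c0EquivSiegel hδ ⟨conjJ γ₀ (auxComplexStructureV F τ Φ v), hC0⟩ : siegelUpperHalfSpace g) : Matrix (Fin g) (Fin g) ℂ) := by
  rw [periodZV, coe_c0EquivSiegel]

omit [NumberField L] [IsCMField L] in
/-- Translating the conjugator: `conjJ (γ₀ N) J = ↑(A′ • ⟨conjJ γ₀ J⟩)` for `A′ = γ₀ N γ₀⁻¹ ∈ spForm δ` (★ `coe_smul_C0`, `conjJ_mul`).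
[cite: Lange2023AbelianVarietiesComplex, §7.1.2 Prop. 7.1.9 (p0328)] -/
theorem conjJ_mul_eq_coe_smul {γ₀ N : GL (Fin g ⊕ Fin g) ℝ} (hA : γ₀ * N * γ₀⁻¹ ∈ spForm δ) {J : Matrix (Fin g ⊕ Fin g) (Fin g ⊕ Fin g) ℝ}
    (hJ : conjJ γ₀ J ∈ C0 δ) :
    conjJ (γ₀ * N) J = (((⟨γ₀ * N * γ₀⁻¹, hA⟩ : spForm δ) • (⟨conjJ γ₀ J, hJ⟩ : C0 δ) : C0 δ) : Matrix (Fin g ⊕ Fin g) (Fin g ⊕ Fin g) ℝ) := by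
  rw [coe_smul_C0]
  change conjJ (γ₀ * N) J = ((γ₀ * N * γ₀⁻¹ : GL (Fin g ⊕ Fin g) ℝ) : Matrix _ _ ℝ) * conjJ γ₀ J *
    (((γ₀ * N * γ₀⁻¹ : GL (Fin g ⊕ Fin g) ℝ)⁻¹ : GL (Fin g ⊕ Fin g) ℝ) : Matrix _ _ ℝ)
  rw [← conjJ_def, ← conjJ_mul, inv_mul_cancel_right]

/-- **THE MÖBIUS LAW (E6-eq, layer (a))**: for `γ₀ ∈ GSp_δ(ℝ)` with `γ₀ J_Φ(v) γ₀⁻¹ ∈ C0 δ` and `γ ∈ U(H)(L⁺)` rational there is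
`A ∈ Sp_{2g}(ℝ)` with `toSpForm hδ A = γ₀ N_γ γ₀⁻¹` (`N_γ = gspRationalToReal δ (auxToGspRatV F (γ, 1))`) and
`Z_{γ₀}(γ^τ v) = A • Z_{γ₀}(v)` in `𝔥_g` (★ `c0EquivSiegel_smul`, Lange Lemma 7.1.7; `A` is UNIQUE since ★ `toSpFormEquiv` is a bijection).
[cite: Lange2023AbelianVarietiesComplex, §7.1.2 Lemma 7.1.7 (p0328)] [cite: Deligne1971TravauxShimura, 1.14–1.15] [cite: Deligne1979ShimuraVarieties, Prop. 2.3.10 (PDF p. 32)] -/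
theorem exists_periodZV_map_mulVec_eq_smul (hδ : ∀ i, 0 < δ i) {γ₀ : GL (Fin g ⊕ Fin g) ℝ} (hγ₀ : γ₀ ∈ gspReal δ)
    (γ : rational (↥(maximalRealSubfield L)) L (IsCMField.complexConj L) n H) {v : Fin n → ℂ}
    (hC0 : conjJ γ₀ (auxComplexStructureV F τ Φ v) ∈ C0 δ) :
    ∃ A : Matrix.symplecticGroup (Fin g) ℝ,
      ((toSpForm hδ A : spForm δ) : GL (Fin g ⊕ Fin g) ℝ) = γ₀ * (gspRationalToReal δ (auxToGspRatV F (γ, 1)) : GL (Fin g ⊕ Fin g) ℝ) * γ₀⁻¹ ∧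
        periodZV M F Φ τ γ₀ (((Matrix.GeneralLinearGroup.map τ (γ : GL (Fin n) L) : GL (Fin n) ℂ) : Matrix (Fin n) (Fin n) ℂ) *ᵥ v) =
          ((A • c0EquivSiegel hδ ⟨conjJ γ₀ (auxComplexStructureV F τ Φ v), hC0⟩ : siegelUpperHalfSpace g) : Matrix (Fin g) (Fin g) ℂ) := by
  have hA : γ₀ * (gspRationalToReal δ (auxToGspRatV F (γ, 1)) : GL (Fin g ⊕ Fin g) ℝ) * γ₀⁻¹ ∈ spForm δ :=
    conj_mem_spForm_of_mem_gspReal hγ₀ (isMultiplier_one_gspRationalToReal_auxToGspRatV_one M F γ)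
  refine ⟨(toSpFormEquiv hδ).symm ⟨_, hA⟩, ?_, ?_⟩
  · rw [← toSpFormEquiv_apply, MulEquiv.apply_symm_apply]
  · have hJ' := conjJ_mul_eq_coe_smul hA hC0 (J := auxComplexStructureV F τ Φ v)
    have hC0' : conjJ (γ₀ * (gspRationalToReal δ (auxToGspRatV F (γ, 1)) : GL (Fin g ⊕ Fin g) ℝ)) (auxComplexStructureV F τ Φ v) ∈ C0 δ := by
      rw [hJ']; exact Subtype.property _
    have hpt : (⟨conjJ (γ₀ * (gspRationalToReal δ (auxToGspRatV F (γ, 1)) : GL (Fin g ⊕ Fin g) ℝ)) (auxComplexStructureV F τ Φ v), hC0'⟩ : C0 δ) =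
        (⟨_, hA⟩ : spForm δ) • ⟨conjJ γ₀ (auxComplexStructureV F τ Φ v), hC0⟩ := Subtype.ext hJ'
    rw [periodZV_map_mulVec, periodZV_eq_c0EquivSiegel M F Φ τ hδ hC0', hpt, ← c0EquivSiegel_smul hδ, ← toSpFormEquiv_apply,
      MulEquiv.apply_symm_apply]

/-! ### §4 The unitary part commutes with the scalars -/

omit [NumberField L] [IsCMField L] in
/-- **`auxRepV ℝ β (1, X) · N_t = N_t · auxRepV ℝ β (1, X)`** for every `X ∈ GL_n(ℝ ⊗ M)` and scalar `t ∈ (ℝ ⊗_ℚ M)ˣ` (`(1, X)(t, 1) = (t, X) = (t, 1)(1, X)`):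
the unitary part — in particular `N_γ` — commutes with the `M ⊗ ℝ`-scalars, the real avatar of the `𝒪_M`-action (A-p06 «`Mρ` commutes with `auxRep γ`»;
with ★ D `auxRepV_scalar_mul_auxComplexStructureVGL`). [cite: Deligne1979ShimuraVarieties, Prop. 2.3.10 (PDF p. 32)] [cite: Milne2005ShimuraVarieties, §8 p. 81] -/
theorem auxRepV_one_mul_auxRepV_scalar (X : GL (Fin n) (ℝ ⊗[ℚ] M)) (t : (ℝ ⊗[ℚ] M)ˣ) :
    auxRepV ℝ F (1, X) * auxRepV ℝ F (t, 1) = auxRepV ℝ F (t, 1) * auxRepV ℝ F (1, X) := by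
  rw [← map_mul, ← map_mul, Prod.mk_mul_mk, Prod.mk_mul_mk, one_mul, mul_one, one_mul, mul_one]

omit [NumberField L] [IsCMField L] in
/-- The same after conjugation by any `γ₀`: `(γ₀ A γ₀⁻¹)(γ₀ B γ₀⁻¹) = (γ₀ B γ₀⁻¹)(γ₀ A γ₀⁻¹)` when `A B = B A`. [cite: Milne2005ShimuraVarieties, §8 p. 81] -/
theorem conj_mul_conj_comm {γ₀ A B : GL (Fin g ⊕ Fin g) ℝ} (h : A * B = B * A) :
    (γ₀ * A * γ₀⁻¹) * (γ₀ * B * γ₀⁻¹) = (γ₀ * B * γ₀⁻¹) * (γ₀ * A * γ₀⁻¹) := by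
  calc (γ₀ * A * γ₀⁻¹) * (γ₀ * B * γ₀⁻¹) = γ₀ * (A * B) * γ₀⁻¹ := by group
    _ = γ₀ * (B * A) * γ₀⁻¹ := by rw [h]
    _ = (γ₀ * B * γ₀⁻¹) * (γ₀ * A * γ₀⁻¹) := by group

/-- **`(γ₀ N_γ γ₀⁻¹)` commutes with `(γ₀ N_t γ₀⁻¹)`** — the Möbius element of §3 commutes with the frame-`γ₀` avatar of every `M ⊗ ℝ`-scalar.
[cite: Deligne1979ShimuraVarieties, Prop. 2.3.10 (PDF p. 32)] [cite: Milne2005ShimuraVarieties, §8 p. 81] -/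
theorem conj_unitary_mul_conj_scalar_comm (γ₀ : GL (Fin g ⊕ Fin g) ℝ)
    (γ : rational (↥(maximalRealSubfield L)) L (IsCMField.complexConj L) n H) (t : (ℝ ⊗[ℚ] M)ˣ) :
    (γ₀ * (gspRationalToReal δ (auxToGspRatV F (γ, 1)) : GL (Fin g ⊕ Fin g) ℝ) * γ₀⁻¹) * (γ₀ * auxRepV ℝ F (t, 1) * γ₀⁻¹) =
      (γ₀ * auxRepV ℝ F (t, 1) * γ₀⁻¹) * (γ₀ * (gspRationalToReal δ (auxToGspRatV F (γ, 1)) : GL (Fin g ⊕ Fin g) ℝ) * γ₀⁻¹) := by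
  apply conj_mul_conj_comm
  rw [coe_gspRationalToReal_auxToGspRatV_one]
  exact auxRepV_one_mul_auxRepV_scalar M F _ t

end AuxV

end UnitaryCurve

end Literature.AlgebraicGeometry.ShimuraVarieties

end
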